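import Mathlib
import HarnessLib
import Summits.Ventures.LatticeQCDFlow.Scoring.GaussianStudentScaleMixture
import Summits.Ventures.LatticeQCDFlow.Scoring.GaussianMeanSquareConcentration
import Summits.Ventures.LatticeQCDFlow.Exactness.NCMCGeneralSpaceReplicaTStatisticStudent

/-!
# A RATE FOR THE STUDENT-TYPE CALIBRATION:
# `0 ≤ N(0,1)([−q, q]) − L_{n+1}(q) ≤ N(0,1)([−q, q]) · √(2/n)`

HONEST FRAMING: exact (Metropolis-corrected) sampling algorithms for lattice gauge theory;
figures of merit are autocorrelation/cost numbers at stated couplings and volumes; no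
continuum-physics claim.

Venture `LatticeQCDFlow` (cell pub-lqcd), topic `Scoring`; FANOUT row 4 (`s0-u1-b`, GEN-33).
NEW WORK of the cell (classical), no definition, nothing cited as a fact.

WHY (row 4).  Rows 4 and 13 list "a rate in `R`" for the convergence of the fixed-count calibration
`L_R(q)` to the nominal `N(0,1)([−q, q])` as NOT CLAIMED.  With the scale mixture
`L_{n+1}(q) = E ψ_q(V_n)` (`Scoring/GaussianStudentScaleMixture`; `V_n` the mean of `n` squared
standard normals, `ψ_q(x) = N(0,1)([−q√x, q√x])`) and the `L¹` concentration
`E|V_n − 1| ≤ √(2/n)` (`Scoring/GaussianMeanSquareConcentration`) an explicit bound is one line of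
convexity: `ψ_q` is increasing and concave on `[0, ∞)` with `ψ_q(0) = 0`, so
`ψ_q(1) − ψ_q(x) ≤ ψ_q(1)·|x − 1|` for every `x ≥ 0`, whence
`N(0,1)([−q,q]) − L_{n+1}(q) ≤ N(0,1)([−q,q])·√(2/n)`.  (The sign `L ≤ N(0,1)([−q,q])` is row 13's
`…ReplicaTStatisticUndercoverage`; the true order is `1/n` — this file claims only `n^{−1/2}` with
the constant `N(0,1)([−q,q]) ≤ 1`.)  Example: with `R = n + 1` batches the deficit of the `q`-bar's
asymptotic coverage below nominal is at most `√(2/n)`; `n = 50` gives `≤ 0.2`, `n = 800` gives `≤ 0.05`.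

## Content

* `gaussianReal_real_Icc_sqrt_mono`, `gaussianReal_real_Icc_sqrt_zero`,
  `gaussianReal_real_Icc_sqrt_one_sub_le` (§1) — `ψ_q` increasing, `ψ_q(0) = 0`,
  `ψ_q(1) − ψ_q(x) ≤ ψ_q(1)|x − 1|` (`x ≥ 0`, `q ≥ 0`).
* **`gaussianReal_sub_studentRatio_le_sqrt`** (§2) — `q ≥ 0`, `n ≥ 1`:
  `N(0,1)([−q,q]) − N(0,1)^{⊗(n+1)}{|z₀| ≤ q√((Σ_{j≥1} z_j²)/n)} ≤ N(0,1)([−q,q])·√(2/n)` (split form);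
  **`gaussianReal_sub_replicaT_coverage_le_sqrt`** — the same for row 13's `L_R(q)` over `Fin (n+2)`
  with rate `√(2/(n+1))`.

Depends on `Scoring/GaussianStudentScaleMixture`, `Scoring/GaussianMeanSquareConcentration`
(row 4 GEN-33) and row 13's BUILT `…ReplicaTStatisticStudent`.  [ours] throughout.
-/

open MeasureTheory ProbabilityTheory Filter Topology Finset

namespace Summit.Ventures.LatticeQCDFlow.Scoring

open Set

/-! ## §1 `ψ_q(1) − ψ_q(x) ≤ ψ_q(1)·|x − 1|` -/

section PsiLipschitz

/-- `ψ_q` is increasing on `ℝ` (`q ≥ 0`): larger `x`, wider interval. [ours] -/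
theorem gaussianReal_real_Icc_sqrt_mono {q : ℝ} (hq : 0 ≤ q) {x y : ℝ} (hxy : x ≤ y) :
    (gaussianReal 0 1).real (Icc (-(q * Real.sqrt x)) (q * Real.sqrt x))
      ≤ (gaussianReal 0 1).real (Icc (-(q * Real.sqrt y)) (q * Real.sqrt y)) := by
  have h : q * Real.sqrt x ≤ q * Real.sqrt y :=
    mul_le_mul_of_nonneg_left (Real.sqrt_le_sqrt hxy) hq
  exact measureReal_mono (Icc_subset_Icc (neg_le_neg h) h)

/-- `ψ_q(0) = 0` (`2∫₀⁰ φ = 0`). [ours] -/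
theorem gaussianReal_real_Icc_sqrt_zero {q : ℝ} (hq : 0 ≤ q) :
    (gaussianReal 0 1).real (Icc (-(q * Real.sqrt 0)) (q * Real.sqrt 0)) = 0 := by
  rw [gaussianReal_real_Icc_sqrt_eq_two_mul_primitive hq, Real.sqrt_zero, mul_zero,
    intervalIntegral.integral_same, mul_zero]

/-- **`ψ_q(1) − ψ_q(x) ≤ ψ_q(1)·|x − 1|` for `x ≥ 0`, `q ≥ 0`**: above `1` the left side is
non-positive (monotonicity); below `1` concavity on `[0, ∞)` between `0` and `1` gives
`ψ_q(x) ≥ x·ψ_q(1)`. [ours] -/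
theorem gaussianReal_real_Icc_sqrt_one_sub_le {q : ℝ} (hq : 0 ≤ q) {x : ℝ} (hx : 0 ≤ x) :
    (gaussianReal 0 1).real (Icc (-(q * Real.sqrt 1)) (q * Real.sqrt 1))
        - (gaussianReal 0 1).real (Icc (-(q * Real.sqrt x)) (q * Real.sqrt x))
      ≤ (gaussianReal 0 1).real (Icc (-(q * Real.sqrt 1)) (q * Real.sqrt 1)) * |x - 1| := by
  set ψ : ℝ → ℝ := fun x => (gaussianReal 0 1).real (Icc (-(q * Real.sqrt x)) (q * Real.sqrt x))
    with hψ
  have hψ1 : 0 ≤ ψ 1 := measureReal_nonneg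
  rcases le_or_gt 1 x with h1x | hx1
  · -- `x ≥ 1`: `ψ x ≥ ψ 1`
    have hmono : ψ 1 ≤ ψ x := gaussianReal_real_Icc_sqrt_mono hq h1x
    have : ψ 1 - ψ x ≤ 0 := by linarith
    exact this.trans (mul_nonneg hψ1 (abs_nonneg _))
  · -- `0 ≤ x < 1`: concavity between `0` and `1`
    have hconc := (concaveOn_gaussianReal_real_Icc_sqrt hq).2 (Set.self_mem_Ici : (0 : ℝ) ∈ Set.Ici 0)
      (Set.mem_Ici.2 (zero_le_one : (0 : ℝ) ≤ 1)) (sub_nonneg.2 hx1.le) hx (by ring)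
    -- `(1 − x)•ψ 0 + x•ψ 1 ≤ ψ ((1 − x)•0 + x•1)`
    simp only [smul_eq_mul, mul_zero, zero_add, mul_one] at hconc
    have h0 : ψ 0 = 0 := gaussianReal_real_Icc_sqrt_zero hq
    change (1 - x) * ψ 0 + x * ψ 1 ≤ ψ x at hconc
    rw [h0, mul_zero, zero_add] at hconc
    rw [abs_of_nonpos (by linarith), neg_sub]
    change ψ 1 - ψ x ≤ ψ 1 * (1 - x)
    nlinarith

end PsiLipschitz

/-! ## §2 The rate -/

section Rate

/-- **RATE OF THE FIXED-COUNT CALIBRATION (split Student-ratio form)**: for `q ≥ 0` and `n ≥ 1`,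
`N(0,1)([−q, q]) − N(0,1)^{⊗(n+1)}{|z₀| ≤ q √((Σ_{j=1}^{n} z_j²)/n)} ≤ N(0,1)([−q, q]) · √(2/n)`. [ours] -/
theorem gaussianReal_sub_studentRatio_le_sqrt {q : ℝ} (hq : 0 ≤ q) {n : ℕ} (hn : 1 ≤ n) :
    (gaussianReal 0 1).real (Icc (-q) q)
        - ((Measure.pi fun _ : Fin (n + 1) => gaussianReal 0 1)
            {z : Fin (n + 1) → ℝ | |z 0| ≤ q * Real.sqrt ((∑ j : Fin n, z j.succ ^ 2) / (n : ℝ))}).toReal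
      ≤ (gaussianReal 0 1).real (Icc (-q) q) * Real.sqrt (2 / (n : ℝ)) := by
  rw [pi_gaussianReal_studentRatio_real_eq_integral q n]
  set Q := Measure.pi fun _ : Fin n => gaussianReal 0 1 with hQ
  set ψ : ℝ → ℝ := fun x => (gaussianReal 0 1).real (Icc (-(q * Real.sqrt x)) (q * Real.sqrt x))
    with hψ
  set V : (Fin n → ℝ) → ℝ := fun w => (∑ j, w j ^ 2) / (n : ℝ) with hV
  have hψ1 : ψ 1 = (gaussianReal 0 1).real (Icc (-q) q) := by
    simp [hψ, Real.sqrt_one]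
  have hψc : Continuous ψ := continuous_gaussianReal_real_Icc_sqrt hq
  have hψb : ∀ x, |ψ x| ≤ 1 := abs_gaussianReal_real_Icc_sqrt_le_one q
  have hVm : Measurable V := by simp only [hV]; fun_prop
  have hV0 : ∀ w, 0 ≤ V w := fun w =>
    div_nonneg (Finset.sum_nonneg fun j _ => sq_nonneg _) (Nat.cast_nonneg n)
  have hint : Integrable (fun w => ψ (V w)) Q :=
    Integrable.of_bound (hψc.measurable.comp hVm).aestronglyMeasurable 1 (ae_of_all _ fun w => hψb _)
  have hmemV : MemLp V 2 Q := by
    have : MemLp (fun w : Fin n → ℝ => ∑ j, w j ^ 2) 2 Q :=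
      memLp_finsetSum _ fun j _ =>
        (memLp_two_sq_gaussianReal).comp_measurePreserving (measurePreserving_eval _ j)
    exact (this.const_mul (n : ℝ)⁻¹).ae_eq (ae_of_all _ fun w => by
      show (n : ℝ)⁻¹ * ∑ j, w j ^ 2 = (∑ j, w j ^ 2) / (n : ℝ)
      rw [div_eq_inv_mul])
  have hintabs : Integrable (fun w => |V w - 1|) Q :=
    ((hmemV.integrable (by norm_num)).sub (integrable_const 1)).abs
  -- pointwise bound, integrated
  have hpt : ∀ w, ψ 1 - ψ (V w) ≤ ψ 1 * |V w - 1| := fun w =>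
    gaussianReal_real_Icc_sqrt_one_sub_le hq (hV0 w)
  have hI : ψ 1 - ∫ w, ψ (V w) ∂Q = ∫ w, (ψ 1 - ψ (V w)) ∂Q := by
    rw [integral_sub (integrable_const _) hint, integral_const, smul_eq_mul, probReal_univ,
      one_mul]
  rw [← hψ1]
  calc ψ 1 - ∫ w, ψ (V w) ∂Q = ∫ w, (ψ 1 - ψ (V w)) ∂Q := hI
    _ ≤ ∫ w, ψ 1 * |V w - 1| ∂Q :=
        integral_mono ((integrable_const _).sub hint) (hintabs.const_mul _) hpt
    _ = ψ 1 * ∫ w, |V w - 1| ∂Q := integral_const_mul _ _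
    _ ≤ ψ 1 * Real.sqrt (2 / (n : ℝ)) :=
        mul_le_mul_of_nonneg_left (pi_gaussianReal_integral_abs_meanSq_sub_one_le hn)
          measureReal_nonneg

/-- **RATE, in the tree's replica-`t` vocabulary**: with `R = n + 2` replicas,
`N(0,1)([−q, q]) − L_R(q) ≤ N(0,1)([−q, q]) · √(2/(R−1))` (`q ≥ 0`). [ours] -/
theorem gaussianReal_sub_replicaT_coverage_le_sqrt {q : ℝ} (hq : 0 ≤ q) (n : ℕ) :
    (gaussianReal 0 1).real (Icc (-q) q)
        - ((Measure.pi fun _ : Fin (n + 2) => gaussianReal 0 1)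
          {z : Fin (n + 2) → ℝ | |(∑ r, z r) / Fintype.card (Fin (n + 2))
            / Real.sqrt ((∑ r, (z r - (∑ r', z r') / Fintype.card (Fin (n + 2))) ^ 2)
              / ((Fintype.card (Fin (n + 2)) : ℝ) * (Fintype.card (Fin (n + 2)) - 1)))| ≤ q}).toReal
      ≤ (gaussianReal 0 1).real (Icc (-q) q) * Real.sqrt (2 / ((n + 1 : ℕ) : ℝ)) := by
  rw [Exactness.GeneralNCMC.pi_gaussianReal_measure_abs_tStat_le_eq_studentRatio
      (0 : Fin (n + 2)) one_ne_zero q]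
  -- the `univ.erase` / `Fintype.card` form is the split form
  have hset : {z : Fin (n + 1 + 1) → ℝ | |z 0| ≤ q * Real.sqrt ((∑ r ∈ univ.erase 0, z r ^ 2)
        / ((Fintype.card (Fin (n + 1 + 1)) : ℝ) - 1))}
      = {z : Fin (n + 1 + 1) → ℝ | |z 0| ≤ q *
          Real.sqrt ((∑ j : Fin (n + 1), z j.succ ^ 2) / ((n + 1 : ℕ) : ℝ))} := by
    ext z
    have h1 : ∑ r ∈ univ.erase 0, z r ^ 2 = ∑ j : Fin (n + 1), z j.succ ^ 2 := by
      rw [Finset.sum_erase_eq_sub (Finset.mem_univ _), Fin.sum_univ_succ]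
      ring
    have h2 : ((Fintype.card (Fin (n + 1 + 1)) : ℝ) - 1) = ((n + 1 : ℕ) : ℝ) := by
      rw [Fintype.card_fin]; push_cast; ring
    simp only [Set.mem_setOf_eq, h1, h2]
  have h := gaussianReal_sub_studentRatio_le_sqrt hq (n := n + 1) (by omega)
  rw [← hset] at h
  exact h

end Rate

end Summit.Ventures.LatticeQCDFlow.Scoring
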